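import Literature.AnabelianGeometry.AbsoluteAnabelian.AbsTopII.TwoTripodNodalProp13x
import Literature.AnabelianGeometry.AbsoluteAnabelian.AbsTopII.Prop13iiDiagonalScope
import Literature.AnabelianGeometry.AbsoluteAnabelian.AbsTopII.Prop13ConjugacyScopeBridge
import Literature.AnabelianGeometry.AbsoluteAnabelian.AbsTopII.DecompositionGroupsProp13ivBridge
import HarnessLib

/-!
# [AbsTopII] Prop 1.3 at the two-vertex nodal datum, IV: the `Π_H`-scope (v1) predicates where `H = I`

S. Mochizuki, *Topics in Absolute Anabelian Geometry II* [AbsTopII] (bib `MochizukiAbsTopII2013`; locators =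
PDF pages of the kurims manuscript `paper:url-585b8d0ad0d9`), §1 Def 1.2 (ii) p. 10 ("each vertex `v` [...]
determines [up to conjugation in `Π_𝔾`] a subgroup `Π_v ⊆ Π_𝔾`"), Prop 1.3 (ii), (iv) p. 11, (viii) p. 12:

> "(ii) If `e` is a node of `𝔾` [...]. If `e` abuts to vertices `v, v′`, then [for appropriate choices of conjugates
> of the various inertia groups involved] we have inclusions `I_v, I_{v′} ⊆ I_e`, and the natural morphism
> `I_v × I_{v′} → I_e` is an open injective homomorphism, with image of index equal to `i^Σ_e`."

PROOF-ONLY companion (abc-iut-f-066 gen 7, follow-on of row «P13x″-TWO-VERTEX») of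
`AbsTopII/TwoTripodNodalDatum.lean`.  The two-vertex nodal datum `M.dpsc` has `Π_H = Π_I = P` (`H = I`: the
outer action on `Π_𝔾` is the Dehn twist only, which fixes the dual graph).  Three v1 typings of Prop 1.3 quantify
conjugating elements over all of `Π_H` (findings F-L4t6g5-1 / erratum E-L4-9 and F-w5d102-g5-1) and their
∀-closures are refuted in the tree BY DATA WITH EDGE-MOVING OUTER ACTIONS.  Here they are DECIDED at an honest
Def 1.2 (ii) datum with trivial outer action on the graph:

* `exists_mem_PiG_conj_DEdge_eq`, `exists_mem_PiG_conj_vertSub_eq` — since `P = Π_𝔾·T = Π_𝔾·U` and `T` (resp.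
  `U`) lies in / centralises the groups at `v_A` (resp. `v_B`), EVERY `P`-conjugate of an edge decomposition group
  `D_ε` or of a verticial subgroup `Π_v` is already a `Π_𝔾`-conjugate;
* hence the v1 `Π_H`-scope predicates that fail only through a non-trivial outer action HOLD here, NO hypothesis:
  `prop13iv_dpsc` — **F-0276 `DPSCData.Prop13iv` (v1)** via abc-iut-w5-d226's bridge `prop13iv_of_prop13iv'` and
  gen 5's `prop13iv'_dpsc`; `prop_1_3_viii_dpsc` — **`DPSCIndexData.Prop_1_3_viii` (v1)** via abc-iut-L4-t6's
  bridge `prop_1_3_viii_of_prop_1_3_viii'` and gen 6's `prop_1_3_viii'_dpsc`;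
* whereas **F-0298 `DPSCIndexData.Prop_1_3_ii` (v1) is FALSE here** (`not_prop_1_3_ii_dpsc`): its branch clause
  also demands the DIAGONAL pair `(v_A, v_A)` at the non-loop node, i.e. two conjugates of `I_{v_A}` inside `I_e`
  meeting trivially (abc-iut-w5-d102's certificate `not_prop_1_3_ii_of_conj_eq_of_prop_1_3_iii'`), and at this datum
  ALL `P`-conjugates of `I_v` inside `I_e` COINCIDE (`conj_vertSec_eq_of_le_IvNode`): for `γ ∈ Π_𝔾` with
  `γTγ⁻¹ ⊆ I_e = Π_e·T`, every commutator `γtγ⁻¹t⁻¹` lies in `(Π_e·T) ∩ Π_𝔾 = Π_e` and is killed by gen 6's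
  conjugation-invariant retraction `Π_𝔾 → Π_e` which is the identity on `Π_e` — so `γ` centralises `T`.  The
  repaired `Prop_1_3_ii'` holds here (gen 5 `prop_1_3_ii'_dpsc`): the datum separates v1 from v2.
HONEST FRAMING: classical profinite group theory at a constructed model (constructed ≠ geometric); instance
decisions for the typed rows, not the printed theorem; nothing here bears on [IUTchIII] Cor 3.12; no side taken.
-/

noncomputable section

open scoped Pointwise

namespace Literature.AnabelianGeometry.AbsoluteAnabelian.AbsTopII.TwoTripodNodal.Model

open Literature.AnabelianGeometry.SemiGraphs
open Literature.AnabelianGeometry.SemiGraphs.SemiGraphOfAnabelioids (IsProSigmaCompletion)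
open Literature.AnabelianGeometry.SemiGraphs.SemiGraphOfAnabelioids.IsProSigmaCompletion
open Literature.AnabelianGeometry.Anabelioids (IsSigmaInteger)
open Literature.GroupTheory.CombinatorialGroupTheory
open Literature.GroupTheory.CombinatorialGroupTheory.PuncturedSurfaceGroup
open _root_.Topology

variable {Sigma : Set ℕ} (M : Model Sigma)

/-! ### Every `P`-conjugate of an edge or vertex group is a `Π_𝔾`-conjugate -/

/-- Conjugation by an element of the centraliser fixes the subgroup. [cite: MochizukiAbsTopII2013, Def 1.2 (ii) p.10] -/
theorem conj_smul_eq_self_of_mem_centralizer {K : Subgroup M.P} {s : M.P}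
    (hs : s ∈ Subgroup.centralizer (K : Set M.P)) : MulAut.conj s • K = K := by
  have hfix : ∀ k ∈ K, MulAut.conj s • k = k := fun k hk => by
    rw [MulAut.smul_def, MulAut.conj_apply, mul_inv_eq_iff_eq_mul]
    exact (Subgroup.mem_centralizer_iff.mp hs k hk).symm
  refine le_antisymm (fun x hx => ?_) (fun k hk => ?_)
  · obtain ⟨k, hk, rfl⟩ := (Subgroup.mem_smul_pointwise_iff_exists _ _ _).mp hx
    rw [hfix k hk]; exact hk
  · exact (Subgroup.mem_smul_pointwise_iff_exists _ _ _).mpr ⟨k, hk, hfix k hk⟩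

/-- If a supplement `S` of `Π_𝔾` (`S·Π_𝔾 = P`) fixes `K` under conjugation, then every `P`-conjugate of `K` is a
`Π_𝔾`-conjugate. [cite: MochizukiAbsTopII2013, Def 1.2 (ii) p.10] -/
theorem exists_mem_PiG_conj_eq {S K : Subgroup M.P} (hS : S ⊔ M.PiG = ⊤) (hSK : ∀ s ∈ S, MulAut.conj s • K = K)
    (g : M.P) : ∃ γ : M.P, γ ∈ M.PiG ∧ MulAut.conj g • K = MulAut.conj γ • K := by
  obtain ⟨γ, hγ, s, hs, rfl⟩ := M.exists_eq_mul_of_sup_eq_top hS g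
  exact ⟨γ, hγ, by rw [map_mul, mul_smul, hSK s hs]⟩

/-- **Every `P`-conjugate of `D_ε` is a `Π_𝔾`-conjugate** (`T ⊆ D_ε` for the edges at `v_A`, `U ⊆ D_ε` at `v_B`).
[cite: MochizukiAbsTopII2013, Def 1.2 (ii) p.10] -/
theorem exists_mem_PiG_conj_DEdge_eq (hne : Sigma.Nonempty) (hprime : ∀ p ∈ Sigma, p.Prime)
    (g : (M.dpsc hne hprime).PiH) (ε : (M.dpsc hne hprime).Edge) :
    ∃ γ : (M.dpsc hne hprime).PiH, γ ∈ (M.dpsc hne hprime).PiG ∧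
      MulAut.conj g • (M.dpsc hne hprime).DEdge ε = MulAut.conj γ • (M.dpsc hne hprime).DEdge ε := by
  rw [dpsc_PiG]
  rcases ε with e | c'
  · simp only [DPSCIndexData.DEdge]
    rw [DvNode_eq_WT]
    exact M.exists_mem_PiG_conj_eq M.T_sup_PiG (fun s hs => Subgroup.conj_smul_eq_self_of_mem (Subgroup.mem_sup_right hs)) g
  · obtain ⟨j⟩ := c'
    simp only [DPSCIndexData.DEdge]
    rw [DvCusp_eq_sup_baseSec]
    exact M.exists_mem_PiG_conj_eq (M.baseSec_sup_PiG j)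
      (fun s hs => Subgroup.conj_smul_eq_self_of_mem (Subgroup.mem_sup_right hs)) g

/-- `I_v` centralises `Π_v` (`T` centralises `Π_{v_A}`, `U` centralises `Π_{v_B}`). [cite: MochizukiAbsTopII2013, Prop 1.3 (iii) p.11] -/
theorem vertSec_le_centralizer_vertSub (hne : Sigma.Nonempty) (hprime : ∀ p ∈ Sigma, p.Prime) (v : Fin 2) :
    M.vertSec v ≤ Subgroup.centralizer ((M.dpsc hne hprime).vertSub ⟨v⟩ : Set (M.dpsc hne hprime).PiH) := by
  have hv : v = 0 ∨ v = 1 := by fin_cases v <;> simp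
  rcases hv with rfl | rfl
  · exact M.T_le_centralizer_vertGpA
  · exact M.U_le_centralizer_vertGpB

/-- **Every `P`-conjugate of `Π_v` is a `Π_𝔾`-conjugate** (`P = I_v·Π_𝔾`, `I_v` centralises `Π_v`) — the outer
action of `H = I` on the graph is trivial. [cite: MochizukiAbsTopII2013, Def 1.2 (ii) p.10] -/
theorem exists_mem_PiG_conj_vertSub_eq (hne : Sigma.Nonempty) (hprime : ∀ p ∈ Sigma, p.Prime)
    (g : (M.dpsc hne hprime).PiH) (v : (M.dpsc hne hprime).Vert) :
    ∃ γ ∈ (M.dpsc hne hprime).PiG,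
      MulAut.conj g • (M.dpsc hne hprime).vertSub v = MulAut.conj γ • (M.dpsc hne hprime).vertSub v := by
  obtain ⟨v⟩ := v
  rw [dpsc_PiG]
  obtain ⟨γ, hγ, h⟩ := M.exists_mem_PiG_conj_eq (K := (M.dpsc hne hprime).vertSub ⟨v⟩) (M.vertSec_sup_PiG v)
    (fun s hs => M.conj_smul_eq_self_of_mem_centralizer (M.vertSec_le_centralizer_vertSub hne hprime v hs)) g
  exact ⟨γ, hγ, h⟩

/-! ### The v1 predicates (iv), (viii) HOLD at the datum -/

/-- **[AbsTopII] Prop 1.3 (iv), v1 typing `DPSCData.Prop13iv` (F-0276, `Π_H`-scope) HOLDS at the two-vertex nodal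
datum, NO hypothesis** — through the v2 instance (gen 5) and the bridge under «every `Π_H`-conjugate of `Π_v` is a
`Π_𝔾`-conjugate». [cite: MochizukiAbsTopII2013, Prop 1.3 (iv) p.11] -/
theorem prop13iv_dpsc (hne : Sigma.Nonempty) (hprime : ∀ p ∈ Sigma, p.Prime) :
    Literature.AnabelianGeometry.AbsoluteAnabelian.DPSCData.Prop13iv (M.dpsc hne hprime).toDPSCData :=
  (M.dpsc hne hprime).toDPSCData.prop13iv_of_prop13iv' (M.exists_mem_PiG_conj_vertSub_eq hne hprime)
    (M.prop13iv'_dpsc hne hprime)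

/-- **[AbsTopII] Prop 1.3 (viii), v1 typing `DPSCIndexData.Prop_1_3_viii` (`Π_H`-scope) HOLDS at the two-vertex
nodal datum, NO hypothesis** — through gen 6's v2 instance and abc-iut-L4-t6's bridge.
[cite: MochizukiAbsTopII2013, Prop 1.3 (viii) p.12] -/
theorem prop_1_3_viii_dpsc (hne : Sigma.Nonempty) (hprime : ∀ p ∈ Sigma, p.Prime) :
    Literature.AnabelianGeometry.AbsoluteAnabelian.AbsTopII.DPSCIndexData.Prop_1_3_viii (M.dpsc hne hprime) :=
  (M.dpsc hne hprime).prop_1_3_viii_of_prop_1_3_viii' (M.prop_1_3_viii'_dpsc hne hprime)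
    (M.exists_mem_PiG_conj_DEdge_eq hne hprime)

/-! ### All conjugates of `I_v` inside `I_e` coincide; the v1 predicate (ii) FAILS -/

/-- **A `Π_𝔾`-element whose conjugate of `I_v` stays inside `I_e = Π_e·I_v` centralises `I_v`.**  For `γ ∈ Π_𝔾` with
`γ I_v γ⁻¹ ⊆ Π_e·I_v`: each commutator `γ s γ⁻¹ s⁻¹` (`s ∈ I_v`) lies in `(Π_e·I_v) ∩ Π_𝔾 = Π_e` and is killed by
the conjugation-invariant retraction `Π_𝔾 → Π_e` (identity on `Π_e`; abc-iut-f-066 gen 6), hence is trivial.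
[cite: MochizukiAbsTopII2013, Prop 1.3 (ii) p.11] -/
theorem mem_centralizer_of_conj_vertSec_le (hne : Sigma.Nonempty) (hprime : ∀ p ∈ Sigma, p.Prime) (v : Fin 2)
    {γ : M.P} (hγ : γ ∈ M.PiG)
    (h : MulAut.conj γ • M.vertSec v ≤ (M.nodeGp).map M.PiG.subtype ⊔ M.vertSec v) :
    γ ∈ Subgroup.centralizer ((M.vertSec v : Subgroup M.P) : Set M.P) := by
  haveI := M.normal_PiG
  -- `(Π_e · I_v) ∩ Π_𝔾 = Π_e`
  have hW : Subgroup.map M.PiG.subtype M.nodeGp ≤ M.PiG := Subgroup.map_subtype_le _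
  have hcomm : ∀ a ∈ Subgroup.map M.PiG.subtype M.nodeGp, ∀ s ∈ M.vertSec v, a * s = s * a := by
    have hv : v = 0 ∨ v = 1 := by fin_cases v <;> simp
    rcases hv with rfl | rfl
    · exact M.W_commute_T
    · exact M.W_commute_U
  have hinf : (Subgroup.map M.PiG.subtype M.nodeGp ⊔ M.vertSec v) ⊓ M.PiG = Subgroup.map M.PiG.subtype M.nodeGp :=
    M.sup_inf_PiG_eq_of_section _ _ hW
      (fun s hs => Subgroup.mem_centralizer_iff.mpr fun a ha => hcomm a ha s hs) (M.vertSec_inf_PiG hne hprime v)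
  -- the retraction onto `Π_e`
  obtain ⟨b, hb0, hb1, hb2⟩ := exists_freeGroupBasis_node
  obtain ⟨R, -, hRid, -, -, hRconj⟩ := M.exists_retraction b 1
  rw [Subgroup.mem_centralizer_iff]
  intro s hs
  -- the commutator `c = γ s γ⁻¹ s⁻¹`
  have hsγ : s * γ⁻¹ * s⁻¹ ∈ M.PiG := M.normal_PiG.conj_mem _ (M.PiG.inv_mem hγ) s
  have hcG : γ * (s * γ⁻¹ * s⁻¹) ∈ M.PiG := M.PiG.mul_mem hγ hsγ
  have hcJ : γ * (s * γ⁻¹ * s⁻¹) ∈ Subgroup.map M.PiG.subtype M.nodeGp ⊔ M.vertSec v := by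
    have h1 : MulAut.conj γ • s ∈ Subgroup.map M.PiG.subtype M.nodeGp ⊔ M.vertSec v :=
      h (Subgroup.smul_mem_pointwise_smul _ _ _ hs)
    rw [MulAut.smul_def, MulAut.conj_apply] at h1
    have h2 := Subgroup.mul_mem _ h1 (Subgroup.mem_sup_right (Subgroup.inv_mem _ hs))
    rwa [show γ * s * γ⁻¹ * s⁻¹ = γ * (s * γ⁻¹ * s⁻¹) by group] at h2
  have hcW : γ * (s * γ⁻¹ * s⁻¹) ∈ Subgroup.map M.PiG.subtype M.nodeGp := by
    rw [← hinf]; exact ⟨hcJ, hcG⟩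
  -- as an element of `Π_𝔾`, it lies in `closure ⟨κG(c₁c₂)⟩`, where `R` is the identity
  have hcW' : (⟨γ * (s * γ⁻¹ * s⁻¹), hcG⟩ : ↥M.PiG) ∈ (Subgroup.zpowers (M.κG (b 1))).topologicalClosure := by
    obtain ⟨x, hx, hxe⟩ := hcW
    rw [hb1, ← nodeGp_eq_closure_zpowers]
    have : x = ⟨γ * (s * γ⁻¹ * s⁻¹), hcG⟩ := Subtype.ext hxe
    rwa [← this]
  have hR1 : R ⟨γ * (s * γ⁻¹ * s⁻¹), hcG⟩ = ⟨γ * (s * γ⁻¹ * s⁻¹), hcG⟩ := hRid _ hcW'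
  -- but `R(γ · (sγ⁻¹s⁻¹)) = R(γ) · R(γ⁻¹) = 1` by conjugation-invariance
  have hR2 : R ⟨γ * (s * γ⁻¹ * s⁻¹), hcG⟩ = 1 := by
    have hmul : (⟨γ * (s * γ⁻¹ * s⁻¹), hcG⟩ : ↥M.PiG) = ⟨γ, hγ⟩ * ⟨s * γ⁻¹ * s⁻¹, hsγ⟩ := rfl
    rw [hmul, map_mul, hRconj s ⟨γ⁻¹, M.PiG.inv_mem hγ⟩ hsγ, ← map_mul]
    have : (⟨γ, hγ⟩ : ↥M.PiG) * ⟨γ⁻¹, M.PiG.inv_mem hγ⟩ = 1 := Subtype.ext (mul_inv_cancel γ)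
    rw [this, map_one]
  have hc1 : γ * (s * γ⁻¹ * s⁻¹) = 1 := by
    have := congrArg Subtype.val (hR1.symm.trans hR2)
    simpa using this
  calc s * γ = (γ * (s * γ⁻¹ * s⁻¹))⁻¹ * (γ * s) := by group
    _ = γ * s := by rw [hc1, inv_one, one_mul]

/-- **All `P`-conjugates of `I_v` contained in `I_e` COINCIDE with `I_v`** (`P = Π_𝔾·I_v`, then the previous lemma).
[cite: MochizukiAbsTopII2013, Prop 1.3 (ii) p.11] -/
theorem conj_vertSec_eq_of_le_IvNode (hne : Sigma.Nonempty) (hprime : ∀ p ∈ Sigma, p.Prime) (v : Fin 2) (g : M.P)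
    (h : MulAut.conj g • M.vertSec v ≤ (M.nodeGp).map M.PiG.subtype ⊔ M.vertSec v) :
    MulAut.conj g • M.vertSec v = M.vertSec v := by
  obtain ⟨γ, hγ, s, hs, rfl⟩ := M.exists_eq_mul_of_sup_eq_top (M.vertSec_sup_PiG v) g
  rw [map_mul, mul_smul, Subgroup.conj_smul_eq_self_of_mem hs] at h ⊢
  exact M.conj_smul_eq_self_of_mem_centralizer (M.mem_centralizer_of_conj_vertSec_le hne hprime v hγ h)

/-- `I_e = Π_e · I_v` for both vertices (`Π_e·T = Π_e·U`). [cite: MochizukiAbsTopII2013, Prop 1.3 (ii) p.11] -/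
theorem IvNode_eq_W_sup_vertSec (hne : Sigma.Nonempty) (hprime : ∀ p ∈ Sigma, p.Prime)
    (e : (M.dpsc hne hprime).Node) (v : Fin 2) :
    (M.dpsc hne hprime).IvNode e = (M.nodeGp).map M.PiG.subtype ⊔ M.vertSec v := by
  have hv : v = 0 ∨ v = 1 := by fin_cases v <;> simp
  rcases hv with rfl | rfl
  · exact M.IvNode_eq_J hne hprime e
  · rw [IvNode_eq_J, vertSec_one, ← T_sup_U_eq_WT, T_sup_U_eq_WU]

/-- **[AbsTopII] Prop 1.3 (ii), v1 typing `DPSCIndexData.Prop_1_3_ii` (F-0298) is FALSE at the two-vertex nodal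
datum** (finding F-w5d102-g5-1 realised at an honest non-loop node with trivial outer action): the diagonal pair
`(v_A, v_A)` would need two conjugates of `I_{v_A}` inside `I_e` meeting trivially, but all of them equal `I_{v_A}`
(`conj_vertSec_eq_of_le_IvNode`) and `I_{v_A} ≅ Ẑ^Σ ≠ 1` (typed Prop 1.3 (iii)′, gen 5).  The repaired
`Prop_1_3_ii'` HOLDS here (gen 5 `prop_1_3_ii'_dpsc`). [cite: MochizukiAbsTopII2013, Prop 1.3 (ii) p.11] -/
theorem not_prop_1_3_ii_dpsc (hne : Sigma.Nonempty) (hprime : ∀ p ∈ Sigma, p.Prime) :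
    ¬ Literature.AnabelianGeometry.AbsoluteAnabelian.AbsTopII.DPSCIndexData.Prop_1_3_ii (M.dpsc hne hprime) := by
  refine (M.dpsc hne hprime).not_prop_1_3_ii_of_conj_eq_of_prop_1_3_iii' (M.prop_1_3_iii'_dpsc hne hprime)
    (e := ⟨()⟩) (v := ⟨(0 : Fin 2)⟩) (M.nodeAbuts_dpsc hne hprime _ _) fun g g' hg hg' => ?_
  rw [Iv_eq_vertSec, M.IvNode_eq_W_sup_vertSec hne hprime ⟨()⟩ 0] at hg hg'
  rw [Iv_eq_vertSec]
  exact (M.conj_vertSec_eq_of_le_IvNode hne hprime 0 g hg).trans (M.conj_vertSec_eq_of_le_IvNode hne hprime 0 g' hg').symm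

/-- **Census form: the two-vertex nodal datum SEPARATES the v1 and v2 typings** — at ONE DPSC datum with two
vertices and trivial outer action on the graph, the `Π_H`-scope v1 predicates (iv) and (viii) HOLD together with
their `Π_𝔾`-scope repairs (iv)′, (viii)′, while the v1 (ii) FAILS and its repair (ii)′ HOLDS; every nonempty set of
primes `Σ`, NO hypothesis. [cite: MochizukiAbsTopII2013, Prop 1.3 p.11] -/
theorem exists_twoVertex_nodal_model_PiH_scope (Sigma : Set ℕ) (hne : Sigma.Nonempty)
    (hprime : ∀ p ∈ Sigma, p.Prime) :
    ∃ X : DPSCIndexData.{0}, X.Sigma = Sigma ∧ (∃ v v' : X.Vert, v ≠ v' ∧ X.Adjacent v v') ∧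
      Literature.AnabelianGeometry.AbsoluteAnabelian.DPSCData.Prop13iv X.toDPSCData ∧
      Literature.AnabelianGeometry.AbsoluteAnabelian.DPSCData.Prop13iv' X.toDPSCData ∧
      Literature.AnabelianGeometry.AbsoluteAnabelian.AbsTopII.DPSCIndexData.Prop_1_3_viii X ∧
      Literature.AnabelianGeometry.AbsoluteAnabelian.AbsTopII.DPSCIndexData.Prop_1_3_viii' X ∧
      ¬ Literature.AnabelianGeometry.AbsoluteAnabelian.AbsTopII.DPSCIndexData.Prop_1_3_ii X ∧
      Literature.AnabelianGeometry.AbsoluteAnabelian.AbsTopII.DPSCIndexData.Prop_1_3_ii' X := by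
  obtain ⟨M⟩ := Model.nonempty Sigma
  exact ⟨M.dpsc hne hprime, rfl, ⟨⟨(0 : Fin 2)⟩, ⟨(1 : Fin 2)⟩, M.vert_zero_ne_one hne hprime, M.adjacent_dpsc hne hprime _ _⟩,
    M.prop13iv_dpsc hne hprime, M.prop13iv'_dpsc hne hprime, M.prop_1_3_viii_dpsc hne hprime,
    M.prop_1_3_viii'_dpsc hne hprime, M.not_prop_1_3_ii_dpsc hne hprime, M.prop_1_3_ii'_dpsc hne hprime⟩

end Literature.AnabelianGeometry.AbsoluteAnabelian.AbsTopII.TwoTripodNodal.Model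

end
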